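import Summits.ABC.ABC.Theorems.DefiniteXiDefiniteRTControlPrimeValTransport
import Summits.ABC.ABC.Theorems.IsogenyGlueCongruenceKenkuPrintedLevelsOfThreeLevels
import Literature.NumberTheory.EllipticCurves.PastenHeightBoundsLemma68LocalProofs
import Literature.NumberTheory.EllipticCurves.MazurTorsionPrimeCaseFromCor44Proofs
import Literature.NumberTheory.EllipticCurves.RationalTwoTorsionModPIrreducibleProofs
import HarnessLib

/-!
# Stub ideas k3 (gen 3) for `stub_pastenLemma68 : PastenShimura2024_lemma_6_8` — FAMILY 3, the extremes,
# pushed to the end: the Frey/odd re-cut is PROVED outright from Mazur Cor. 4.4 + Klein–Fricke(13)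

Lean companion of `STUB-IDEAS-stub_pastenLemma68-3.md` (gen 3; crux `DefiniteRTControlPrime`,
stmt-ABC-11338).  `lean check` rc 0, **ZERO `sorry`**.  Self-contained successor of the gen-2 file
`StubIdeasK3G2PastenLemma68.lean` (namespace `…StubIdeas3G3`, four sorries H4a/H5/H6/H7): here

* H4a `compositeRows_valuation_le_one` is PROVED (`2`-power denominators are units at odd places of `ℤ`);
* H7 (Frey `2`-torsion pointwise `Γ_ℚ`-fixed) is the LANDED `smul_eq_of_two_nsmul_eq_zero_freyCurve`
  (Darmon–Merel 1997, Lemma 1.2 (1), `RationalTwoTorsionModPIrreducibleProofs`);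
* H5 (`13 ↦ 26`) and H6 (`5 ↦ 20` on the `2`-neighbour) are REPLACED by the LANDED Darmon–Merel road
  through `X₀(4p)`: `hasIrreducibleModPGaloisRep_of_rational_two_torsion_of_degree_ne`
  (`Theorems/DefiniteXiFreyModularityStubDegreeNeTwenty`, built for crux `FreyModularity`) + the landed
  levels `20` (`kenku_levelTwenty`) and `26` (`isCyclic_degree_ne_twentySix h13`, via `52 → 26` divisor
  closure) ⇒ `5 ∤ deg ψ`, `13 ∤ deg ψ` for every cyclic `ℚ`-isogeny `ψ` out of a Frey curve
  (`not_five_dvd_degree_freyCurve`, `not_thirteen_dvd_degree_freyCurve`);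

so `lemma68FreyOdd_of_cor44_of_kleinFricke13 (h44 : Mazur1978.cor44_valuation_j_le_one)
(h13 : kleinFrickeThirteen_exists_j_eq) : Lemma68FreyOdd` — the literal instance of Lemma 6.8 that the
skeleton's `stub_valTransport` consumes (reshape certificate `valTransport_of_lemma68FreyOdd`, §9) — is a
REAL PROOF, and so are the Frey-class radius `≤ 163` and Plan B (`Lemma68Odd` from h44 + h13 + the three
open levels `65, 125, 169`).  Remaining debt of the re-cut leaf: exactly {Mazur 1978 Cor. 4.4 (item
stmt-ABC-18223 `MazurCor44`), Klein–Fricke level 13 (cite-only fact)} — no `j`-table, no Thm 1, no Prop. 5.1.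
-/
set_option linter.dupNamespace false
set_option linter.unusedVariables false

noncomputable section

open scoped Classical
open WeierstrassCurve IsDedekindDomain NumberField
open Literature.NumberTheory.EllipticCurves Literature.NumberTheory.EllipticCurves.ModularForms
open Summit.ABC.ABC.Theorems

namespace Summit.ABC.ABC.Cruxes.DefiniteRTControlPrime.StubIdeas3G3

/-! ## 0. The two re-cut targets (slices of the verbatim stub) -/

/-- Lemma 6.8 at ODD places only. -/
def Lemma68Odd : Prop :=
  ∀ (W W' : WeierstrassCurve ℚ) [W.IsElliptic] [W'.IsElliptic], W.IsIsogenous W' →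
    ∀ v : HeightOneSpectrum ℤ, Rat.HeightOneSpectrum.natGenerator v ≠ 2 →
      W.HasMultiplicativeReductionAt v →
        ∃ m n : ℕ, 0 < m ∧ m ≤ 163 ∧ 0 < n ∧ n ≤ 163 ∧
          W.ordMinimalDiscriminant v * n = W'.ordMinimalDiscriminant v * m

/-- Lemma 6.8 at a FREY source and an ODD place — literally the instance `stub_valTransport` consumes. -/
def Lemma68FreyOdd : Prop :=
  ∀ (a b : ℤ), IsCoprime a b → a * b * (a + b) ≠ 0 →
    ∀ (W' : WeierstrassCurve ℚ) [W'.IsElliptic], (freyCurve a b).IsIsogenous W' →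
      ∀ v : HeightOneSpectrum ℤ, Rat.HeightOneSpectrum.natGenerator v ≠ 2 →
        (freyCurve a b).HasMultiplicativeReductionAt v →
          ∃ m n : ℕ, 0 < m ∧ m ≤ 163 ∧ 0 < n ∧ n ≤ 163 ∧
            (freyCurve a b).ordMinimalDiscriminant v * n = W'.ordMinimalDiscriminant v * m

theorem lemma68Odd_of_lemma68 (h : PastenShimura2024_lemma_6_8) : Lemma68Odd :=
  fun W W' _ _ hiso v _ hv ↦ h W W' hiso v hv

theorem lemma68FreyOdd_of_lemma68Odd (h : Lemma68Odd) : Lemma68FreyOdd := by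
  intro a b hab h0 W' _ hiso v hv2 hv
  haveI := isElliptic_freyCurve h0
  exact h (freyCurve a b) W' hiso v hv2 hv

/-! ## 1. Pointwise: an isogeny of degree `≤ 163` gives Lemma 6.8 at `(W, W', v)` (H0, proved) -/

/-- (H0) Lemma 6.8 at one triple from ONE isogeny `W → W'` of degree `≤ 163` (not necessarily cyclic). -/
theorem lemma68At_of_degree_le {W W' : WeierstrassCurve ℚ} [W.IsElliptic] [W'.IsElliptic]
    (φ : Isogeny W W') (hφ : φ.degree ≤ 163) (v : HeightOneSpectrum ℤ)
    (hv : W.HasMultiplicativeReductionAt v) :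
    ∃ m n : ℕ, 0 < m ∧ m ≤ 163 ∧ 0 < n ∧ n ≤ 163 ∧
      W.ordMinimalDiscriminant v * n = W'.ordMinimalDiscriminant v * m := by
  have hv' : W'.HasMultiplicativeReductionAt v := hasMultiplicativeReductionAt_of_isIsogenous ⟨φ⟩ v hv
  obtain ⟨ψ, hψ, hdvd⟩ := φ.exists_isCyclic_degree_dvd
  obtain ⟨a, b, ha, hb, hab, h⟩ :=
    exists_ordMinimalDiscriminant_mul_eq_mul_of_isCyclic ψ.degree ψ hψ rfl v hv hv'
  have hψle : ψ.degree ≤ 163 := (Nat.le_of_dvd φ.degree_pos hdvd).trans hφ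
  have hab' : a * b ≤ 163 := (Nat.le_of_dvd ψ.degree_pos hab).trans hψle
  refine ⟨a, b, ha, ?_, hb, ?_, h⟩ <;> nlinarith

/-! ## 2. Generic pointwise radius from prime support + covering barrier (H2, proved) -/

/-- Elementary (copy of the private `exists_dvd_gt_le_sq` of `…MazurKenkuBoundStubRadius`). -/
theorem exists_dvd_gt_le_sq' {n : ℕ} (hn : 163 < n)
    (hp : ∀ p : ℕ, p.Prime → p ∣ n → p ≤ 163) :
    ∃ d, d ∣ n ∧ 163 < d ∧ d ≤ 163 * 163 := by
  have hex : ∃ e, e ∣ n ∧ 163 < e := ⟨n, dvd_rfl, hn⟩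
  refine ⟨Nat.find hex, (Nat.find_spec hex).1, (Nat.find_spec hex).2, ?_⟩
  by_contra hgt
  rw [not_le] at hgt
  obtain ⟨hdn, hd⟩ := Nat.find_spec hex
  obtain ⟨p, hpp, hpd⟩ := Nat.exists_prime_and_dvd (show Nat.find hex ≠ 1 by omega)
  have hple : p ≤ 163 := hp p hpp (hpd.trans hdn)
  obtain ⟨m, hm⟩ := hpd
  have hmd : m ∣ Nat.find hex := Dvd.intro_left p hm.symm
  have hm163 : 163 < m := by
    by_contra hmle
    have := Nat.mul_le_mul hple (not_lt.mp hmle)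
    omega
  have hmlt : m < Nat.find hex := by
    rw [hm]
    exact lt_mul_of_one_lt_left (by omega) hpp.one_lt
  exact Nat.find_min hex hmlt ⟨hmd.trans hdn, hm163⟩

/-- (H2) **Pointwise radius, generic in the support `S` and the barrier `B`.** For a FIXED source `W`:
if every prime dividing the degree of a cyclic `ℚ`-isogeny out of `W` lies in `S ⊆ [1,163]`, every
`S`-smooth `d ∈ (163, 163²]` has a divisor in `B`, and no cyclic isogeny out of `W` has degree in
`B`, then every curve `ℚ`-isogenous to `W` is reached from `W` by an isogeny of degree `≤ 163`. -/
theorem radius_at_of_support_of_barrier (S B : Finset ℕ) (hS : ∀ p ∈ S, p ≤ 163)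
    (hcov : ∀ d ∈ Finset.Ioc 163 (163 * 163), (∀ p ∈ d.primeFactors, p ∈ S) → ∃ b ∈ B, b ∣ d)
    {W : WeierstrassCurve ℚ} [W.IsElliptic]
    (hsupp : ∀ (W'' : WeierstrassCurve ℚ) [W''.IsElliptic] (φ : Isogeny W W''), φ.IsCyclic →
      ∀ p : ℕ, p.Prime → p ∣ φ.degree → p ∈ S)
    (hexcl : ∀ (W'' : WeierstrassCurve ℚ) [W''.IsElliptic] (φ : Isogeny W W''), φ.IsCyclic →
      φ.degree ∉ B)
    {W' : WeierstrassCurve ℚ} [W'.IsElliptic] (hiso : W.IsIsogenous W') :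
    ∃ φ : Isogeny W W', φ.degree ≤ 163 := by
  obtain ⟨ψ, hψ⟩ := hiso.exists_isCyclic
  refine ⟨ψ, ?_⟩
  by_contra hlt
  rw [not_le] at hlt
  have hprime : ∀ p : ℕ, p.Prime → p ∣ ψ.degree → p ∈ S := fun p hp hpd ↦ hsupp W' ψ hψ p hp hpd
  obtain ⟨d₁, hd₁n, hlt₁, hle₁⟩ :=
    exists_dvd_gt_le_sq' hlt fun p hp hpd ↦ hS p (hprime p hp hpd)
  have hd₁S : ∀ p ∈ d₁.primeFactors, p ∈ S := fun p hp ↦ by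
    obtain ⟨hpp, hpd, -⟩ := Nat.mem_primeFactors.mp hp
    exact hprime p hpp (hpd.trans hd₁n)
  obtain ⟨b, hbB, hbd⟩ := hcov d₁ (Finset.mem_Ioc.mpr ⟨hlt₁, hle₁⟩) hd₁S
  obtain ⟨W'', hW'', χ, hχ, hχd, -⟩ := ψ.exists_isCyclic_degree_eq_of_dvd hψ (hbd.trans hd₁n)
  haveI := hW''
  exact hexcl W'' χ hχ (hχd ▸ hbB)

/-! ## 3. The two barrier covers (H3F, H3O: finite checks, proved by `decide +kernel`) -/

/-- Core check, Frey slice: every `d ∈ (163, 163²]` dividing `42¹⁵` has a divisor in `{21,27,32,49}`. -/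
theorem freyBarrier_covers_core :
    ∀ d ∈ Finset.Ioc 163 (163 * 163), 2232232135326160725639168 % d = 0 →
      ∃ b ∈ ({21, 27, 32, 49} : Finset ℕ), b ∣ d := by
  decide +kernel

theorem frey_pow_fifteen_dvd : ∀ p ∈ ({2, 3, 7} : Finset ℕ), p ^ 15 ∣ 2232232135326160725639168 := by
  decide +kernel

/-- Core check, odd slice: every `d ∈ (163, 163²]` dividing `2730¹⁵` has a divisor in `B_odd`. -/
theorem oddBarrier_covers_core :
    ∀ d ∈ Finset.Ioc 163 (163 * 163),
      3486901710858771471857936291044591857000000000000000 % d = 0 →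
      ∃ b ∈ ({15, 20, 21, 26, 27, 32, 35, 49, 65, 125, 169} : Finset ℕ), b ∣ d := by
  decide +kernel

theorem odd_pow_fifteen_dvd : ∀ p ∈ ({2, 3, 5, 7, 13} : Finset ℕ),
    p ^ 15 ∣ 3486901710858771471857936291044591857000000000000000 := by
  decide +kernel

/-- From the core check to the prime-factor form (the landed `lite_covers` argument, generic). -/
theorem covers_of_core (S B : Finset ℕ) (M : ℕ) (hM : ∀ p ∈ S, p ^ 15 ∣ M)
    (hcore : ∀ d ∈ Finset.Ioc 163 (163 * 163), M % d = 0 → ∃ b ∈ B, b ∣ d) :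
    ∀ d ∈ Finset.Ioc 163 (163 * 163), (∀ p ∈ d.primeFactors, p ∈ S) → ∃ b ∈ B, b ∣ d := by
  intro d hd hS
  refine hcore d hd (Nat.mod_eq_zero_of_dvd ?_)
  obtain ⟨hd163, hd26569⟩ := Finset.mem_Ioc.mp hd
  refine (Nat.dvd_iff_prime_pow_dvd_dvd _ _).mpr fun p k hp hpk => ?_
  rcases Nat.eq_zero_or_pos k with rfl | hk
  · exact (pow_zero p).symm ▸ one_dvd _
  have hpd : p ∣ d := (dvd_pow_self p hk.ne').trans hpk
  have hp_mem : p ∈ S := hS p (Nat.mem_primeFactors.mpr ⟨hp, hpd, by omega⟩)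
  have hk15 : k ≤ 15 := by
    have h1 : p ^ k ≤ d := Nat.le_of_dvd (by omega) hpk
    have h2 : 2 ^ k ≤ p ^ k := Nat.pow_le_pow_left hp.two_le k
    by_contra hk15
    have h3 : 2 ^ 16 ≤ 2 ^ k := Nat.pow_le_pow_right (by norm_num) (by omega)
    norm_num at h3
    omega
  exact (pow_dvd_pow p hk15).trans (hM p hp_mem)

/-- (H3F) The Frey barrier `{21, 27, 32, 49}` covers every `{2,3,7}`-smooth `d ∈ (163, 163²]`. -/
theorem freyBarrier_covers :
    ∀ d ∈ Finset.Ioc 163 (163 * 163), (∀ p ∈ d.primeFactors, p ∈ ({2, 3, 7} : Finset ℕ)) →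
      ∃ b ∈ ({21, 27, 32, 49} : Finset ℕ), b ∣ d :=
  covers_of_core _ _ _ frey_pow_fifteen_dvd freyBarrier_covers_core

/-- (H3O) The odd barrier covers every `{2,3,5,7,13}`-smooth `d ∈ (163, 163²]`. -/
theorem oddBarrier_covers :
    ∀ d ∈ Finset.Ioc 163 (163 * 163), (∀ p ∈ d.primeFactors, p ∈ ({2, 3, 5, 7, 13} : Finset ℕ)) →
      ∃ b ∈ ({15, 20, 21, 26, 27, 32, 35, 49, 65, 125, 169} : Finset ℕ), b ∣ d :=
  covers_of_core _ _ _ odd_pow_fifteen_dvd oddBarrier_covers_core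

/-! ## 4. Odd-place prime support from Mazur Cor. 4.4 ALONE (H1 proved from H1a, H1b) -/

/-- (H1a, PROVED) The `p`-part of a cyclic kernel is a `Γ_ℚ`-stable subgroup of `E[p]` of order `p`
(`Isogeny.natCard_ker_inf_geomTorsion_of_isCyclic` + `smul_mem_ker_inf_geomTorsion`, transported to
`AddSubgroup (geomTorsion W p)` along the subtype). -/
theorem exists_stable_natCard_eq_of_isCyclic_dvd {W W'' : WeierstrassCurve ℚ} [W.IsElliptic]
    [W''.IsElliptic] (φ : Isogeny W W'') (hφ : φ.IsCyclic) {p : ℕ} (hp : p.Prime)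
    (hpd : p ∣ φ.degree) :
    ∃ C : AddSubgroup (geomTorsion W (p : ℤ)),
      (∀ σ : Field.absoluteGaloisGroup ℚ, ∀ P ∈ C, σ • P ∈ C) ∧ Nat.card C = p := by
  set H := φ.toAddMonoidHom.ker ⊓ geomTorsion W (p : ℤ) with hH
  refine ⟨H.addSubgroupOf (geomTorsion W (p : ℤ)), ?_, ?_⟩
  · intro σ P hP
    rw [AddSubgroup.mem_addSubgroupOf] at hP ⊢
    exact φ.smul_mem_ker_inf_geomTorsion (p : ℤ) σ hP
  · rw [Nat.card_congr (AddSubgroup.addSubgroupOfEquivOfLe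
      (inf_le_right : H ≤ geomTorsion W (p : ℤ))).toEquiv]
    exact φ.natCard_ker_inf_geomTorsion_of_isCyclic hφ hpd

/-- (H1b, PROVED) The `ℤ`-place / `𝓞 ℚ`-place bridge for "`v(j) < 0` at an odd multiplicative place":
`conductorExponent_eq_one_iff_holds` + `conductorExponent_eq_of_primesEquiv_eq` transport
multiplicativity to the place of `𝓞 ℚ` over the same prime, then *AEC* VII.5.1(b)
(`one_lt_valuation_j_of_hasMultiplicativeReduction_localMinimalModel`); oddness by
`Mazur1978.two_not_mem_asIdeal_of_ne_two`. -/
theorem exists_oddPlace_one_lt_valuation_j {W : WeierstrassCurve ℚ} [W.IsElliptic]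
    {v : HeightOneSpectrum ℤ} (hv2 : Rat.HeightOneSpectrum.natGenerator v ≠ 2)
    (hv : W.HasMultiplicativeReductionAt v) :
    ∃ v' : HeightOneSpectrum (𝓞 ℚ), (2 : 𝓞 ℚ) ∉ v'.asIdeal ∧ 1 < v'.valuation ℚ W.j := by
  -- the place of `𝓞 ℚ` above the same prime (transport as in `hasMultiplicativeReductionAt_of_isIsogenous`)
  set v' : HeightOneSpectrum (𝓞 ℚ) :=
    (Rat.HeightOneSpectrum.primesEquiv (R := 𝓞 ℚ)).symm
      (Rat.HeightOneSpectrum.primesEquiv v) with hv'def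
  have hvv' : (Rat.HeightOneSpectrum.primesEquiv v : Nat.Primes) =
      Rat.HeightOneSpectrum.primesEquiv v' := by
    rw [hv'def, Equiv.apply_symm_apply]
  have h1 : W.conductorExponent v = 1 := (conductorExponent_eq_one_iff_holds v W).mpr hv
  rw [conductorExponent_eq_of_primesEquiv_eq v v' W hvv'] at h1
  have hW : W.HasMultiplicativeReductionAt v' := (conductorExponent_eq_one_iff_holds v' W).mp h1
  refine ⟨v', Mazur1978.two_not_mem_asIdeal_of_ne_two v' ?_,
    one_lt_valuation_j_of_hasMultiplicativeReduction_localMinimalModel v' W hW⟩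
  rw [← hvv']
  exact hv2

/-- (H1) **Prime support at an odd multiplicative place, from Cor. 4.4 alone** (no Thm 1, no
Prop. 5.1, no `j`-tables): a prime `p` dividing the degree of a cyclic `ℚ`-isogeny out of a curve
multiplicative at an odd place is one of `2, 3, 5, 7, 13` — for `p = 11` or `p ≥ 17`, Cor. 4.4 makes
`j` integral at every odd place, contradicting `v(j) < 0`. -/
theorem mem_oddSupport_of_cor44 (h44 : Mazur1978.cor44_valuation_j_le_one)
    {W W'' : WeierstrassCurve ℚ} [W.IsElliptic] [W''.IsElliptic] (φ : Isogeny W W'')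
    (hφ : φ.IsCyclic) {v : HeightOneSpectrum ℤ} (hv2 : Rat.HeightOneSpectrum.natGenerator v ≠ 2)
    (hv : W.HasMultiplicativeReductionAt v) {p : ℕ} (hp : p.Prime) (hpd : p ∣ φ.degree) :
    p ∈ ({2, 3, 5, 7, 13} : Finset ℕ) := by
  by_contra hnot
  haveI : Fact p.Prime := ⟨hp⟩
  obtain ⟨v', hv'2, hv'j⟩ := exists_oddPlace_one_lt_valuation_j hv2 hv
  exact absurd (h44 W p (Mazur1978.eq_eleven_or_seventeen_le_of_not_mem hp hnot)
    (exists_stable_natCard_eq_of_isCyclic_dvd φ hφ hp hpd) v' hv'2) (not_le.mpr hv'j)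

/-! ## 5. Exclusions at an odd multiplicative source (H4) -/

/-- The nine rows of Kenku's table at the composite levels `15, 21, 27` (verbatim the literal of
`KenkuCompositeTables`, stmt-ABC-18225, PROVED in the tree as `kenkuCompositeTables_proof`). -/
def compositeRows : Finset (ℕ × ℚ) :=
  {((15 : ℕ), (-25 / 2 : ℚ)), (15, -349938025 / 8), (15, -121945 / 32), (15, 46969655 / 32768),
    (21, -140625 / 8), (21, 3375 / 2), (21, -1159088625 / 2097152), (21, -189613868625 / 128),
    (27, -12288000)}

/-- `v(N / 2^k) ≤ 1` at every place `v ∤ 2` of `ℤ` (`Rat.valuation_intCast_eq_one_iff`: `v(2) = 1`;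
`HeightOneSpectrum.valuation_le_one` on `ℤ`). (PROVED) -/
theorem valuation_intCast_div_two_pow_le_one (v : HeightOneSpectrum ℤ)
    (hv2 : Rat.HeightOneSpectrum.natGenerator v ≠ 2) (N : ℤ) (k : ℕ) :
    v.valuation ℚ ((N : ℚ) / 2 ^ k) ≤ 1 := by
  have h2 : v.valuation ℚ ((2 : ℤ) : ℚ) = 1 := by
    rw [Rat.valuation_intCast_eq_one_iff]
    intro h
    have h' : Rat.HeightOneSpectrum.natGenerator v ∣ 2 := by exact_mod_cast h
    exact hv2 ((Nat.prime_dvd_prime_iff_eq (Rat.HeightOneSpectrum.prime_natGenerator v)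
      Nat.prime_two).mp h')
  have h2' : v.valuation ℚ (2 : ℚ) = 1 := by simpa using h2
  rw [map_div₀, map_pow, h2', one_pow, div_one,
    show (N : ℚ) = algebraMap ℤ ℚ N from (eq_intCast _ N).symm]
  exact v.valuation_le_one N

/-- (H4a, PROVED — was `sorry` in gen 2) The nine tabulated `j`-values have `2`-power denominators
(`2, 2³, 2⁵, 2¹⁵, 2³, 2, 2²¹, 2⁷, 1`), hence are integral at every ODD place of `ℤ`. -/
theorem compositeRows_valuation_le_one (v : HeightOneSpectrum ℤ)
    (hv2 : Rat.HeightOneSpectrum.natGenerator v ≠ 2) :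
    ∀ r ∈ compositeRows, v.valuation ℚ r.2 ≤ 1 := by
  have key : ∀ (N : ℤ) (k : ℕ) (x : ℚ), x = (N : ℚ) / 2 ^ k → v.valuation ℚ x ≤ 1 := by
    intro N k x hx
    rw [hx]
    exact valuation_intCast_div_two_pow_le_one v hv2 N k
  intro r hr
  simp only [compositeRows, Finset.mem_insert, Finset.mem_singleton] at hr
  rcases hr with rfl | rfl | rfl | rfl | rfl | rfl | rfl | rfl | rfl
  · exact key (-25) 1 _ (by norm_num)
  · exact key (-349938025) 3 _ (by norm_num)
  · exact key (-121945) 5 _ (by norm_num)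
  · exact key 46969655 15 _ (by norm_num)
  · exact key (-140625) 3 _ (by norm_num)
  · exact key 3375 1 _ (by norm_num)
  · exact key (-1159088625) 21 _ (by norm_num)
  · exact key (-189613868625) 7 _ (by norm_num)
  · exact key (-12288000) 0 _ (by norm_num)

/-- `v(j) < 0` at a multiplicative place of `ℤ` (AEC VII.5.1(b), the tree's
`one_lt_valuation_j_of_hasMultiplicativeReduction_localMinimalModel` at `A = ℤ`). (PROVED) -/
theorem one_lt_valuation_j_at {W : WeierstrassCurve ℚ} [W.IsElliptic] (v : HeightOneSpectrum ℤ)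
    (hv : W.HasMultiplicativeReductionAt v) : 1 < v.valuation ℚ W.j :=
  one_lt_valuation_j_of_hasMultiplicativeReduction_localMinimalModel v W hv

/-- (H4b, PROVED) Levels `15, 21, 27` are impossible for a cyclic isogeny OUT OF a curve
with an odd multiplicative place: the landed `kenkuCompositeTables_proof` puts `(deg, j)` in the nine
rows, whose `j` are integral at odd places (H4a), while `v(j) < 0`. -/
theorem isCyclic_degree_not_mem_oddTables {W W'' : WeierstrassCurve ℚ} [W.IsElliptic]
    [W''.IsElliptic] (φ : Isogeny W W'') (hφ : φ.IsCyclic) {v : HeightOneSpectrum ℤ}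
    (hv2 : Rat.HeightOneSpectrum.natGenerator v ≠ 2) (hv : W.HasMultiplicativeReductionAt v) :
    φ.degree ∉ ({15, 21, 27} : Finset ℕ) := by
  intro hmem
  have hrow : (φ.degree, W.j) ∈ compositeRows := kenkuCompositeTables_proof W W'' φ hφ hmem
  exact absurd (compositeRows_valuation_le_one v hv2 _ hrow) (not_le.mpr (one_lt_valuation_j_at v hv))

/-! ## 6. The Frey extras are ALREADY LANDED: Darmon–Merel's road through `X₀(4p)` (gen-2 H5/H6/H7 discharged) -/

/-- (H7, NOW BY NAME) The Frey curve `y² = x(x-a)(x+b)` has all of `E[2]` pointwise `Γ_ℚ`-fixed: the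
landed `smul_eq_of_two_nsmul_eq_zero_freyCurve` (Darmon–Merel 1997, Lemma 1.2 (1)). -/
theorem freyCurve_geomTorsion_two_fixed {a b : ℤ} (h0 : a * b * (a + b) ≠ 0) :
    haveI := isElliptic_freyCurve h0
    ∀ σ : Field.absoluteGaloisGroup ℚ, ∀ P ∈ geomTorsion (freyCurve a b) (2 : ℤ), σ • P = P :=
  fun σ P hP ↦ smul_eq_of_two_nsmul_eq_zero_freyCurve h0 σ
    ((AddSubgroup.torsionBy.nsmul_iff (A := (freyCurve a b).geomPoints) (n := 2)).mp hP)

/-- **Darmon–Merel 1997, Thm 2.2 by the road through `X₀(4p)`** — VERBATIM COPY of the landed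
`Summit.ABC.ABC.Theorems.hasIrreducibleModPGaloisRep_of_rational_two_torsion_of_degree_ne`
(`Theorems/DefiniteXiFreyModularityStubDegreeNeTwenty.lean`, accepted for crux `FreyModularity`), inlined
here (primed name) only because that module is not in the farm's build set at the time of writing; a
Theorems-side consumer imports the original instead.  Full rational `2`-torsion + no rational cyclic
`4p`-isogeny ⇒ `E[p]` irreducible. [cite: DarmonMerel1997, Thm. 2.2 (with Lemma 1.2 (1))] -/
theorem hasIrreducibleModPGaloisRep_of_rational_two_torsion_of_degree_ne'
    (W : WeierstrassCurve ℚ) [W.IsElliptic]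
    (h2 : ∀ (σ : Field.absoluteGaloisGroup ℚ) (P : W.geomPoints), 2 • P = 0 → σ • P = P)
    {p : ℕ} (hp : p.Prime) (hp2 : p ≠ 2)
    (h4p : ∀ (W₁ W₂ : WeierstrassCurve ℚ) [W₁.IsElliptic] [W₂.IsElliptic] (φ : Isogeny W₁ W₂),
      φ.IsCyclic → φ.degree ≠ 4 * p) :
    W.HasIrreducibleModPGaloisRep p := by
  -- adapted from
  -- Literature/NumberTheory/EllipticCurves/RationalTwoTorsionModPIrreducibleProofs.lean
  -- (`hasIrreducibleModPGaloisRep_of_rational_two_torsion_of_mazurKenku`, Steps 1–4 verbatim;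
  -- its Steps 5–7, unwinding the existential Mazur–Kenku fact, are replaced by `h4p`)
  classical
  have h2p : 2 < p := lt_of_le_of_ne hp.two_le (Ne.symm hp2)
  haveI : Fact p.Prime := ⟨hp⟩
  haveI : NeZero (p : ℚ) := ⟨Nat.cast_ne_zero.mpr hp.ne_zero⟩
  have hpodd : Odd p := hp.odd_of_ne_two hp2
  by_contra hred
  obtain ⟨H, hHstab, hHcard⟩ :=
    (Mazur1978.not_hasIrreducibleModPGaloisRep_iff_exists_natCard_eq W p).mp hred
  /- Step 1: the stable line as a finite `Γ_ℚ`-stable subgroup `S = ⟨s₀⟩` of `E(ℚ̄)`, order `p`. -/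
  set S : AddSubgroup W.geomPoints := H.map (geomTorsion W (p : ℤ)).subtype with hS
  have hScard : Nat.card S = p := by
    rw [← hHcard]
    exact Nat.card_congr (H.equivMapOfInjective _ (geomTorsion W (p : ℤ)).subtype_injective).symm
  have hSstab : ∀ (σ : Field.absoluteGaloisGroup ℚ) (P : W.geomPoints),
      P ∈ S → σ • P ∈ S := by
    rintro σ P ⟨Q, hQ, rfl⟩
    exact ⟨σ • Q, hHstab σ Q hQ, rfl⟩
  haveI : Finite S := Nat.finite_of_card_ne_zero (hScard ▸ hp.ne_zero)
  have hSne : S ≠ ⊥ := by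
    intro h
    rw [h, AddSubgroup.card_bot] at hScard
    exact hp.one_lt.ne hScard
  obtain ⟨⟨s₀, hs₀S⟩, hs₀⟩ := AddSubgroup.ne_bot_iff_exists_ne_zero.1 hSne
  have hs₀0 : s₀ ≠ 0 := fun h0 ↦ hs₀ (Subtype.ext h0)
  have hps₀ : p • s₀ = 0 := by
    have h0 : Nat.card S • (⟨s₀, hs₀S⟩ : S) = 0 := card_nsmul_eq_zero'
    rw [hScard] at h0
    have := congrArg Subtype.val h0
    rwa [AddSubmonoidClass.coe_nsmul] at this
  have hord₀ : addOrderOf s₀ = p := addOrderOf_eq_prime hps₀ hs₀0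
  have hSeq : S = AddSubgroup.zmultiples s₀ := by
    symm
    apply AddSubgroup.eq_of_le_of_card_ge (AddSubgroup.zmultiples_le.2 hs₀S)
    rw [hScard, Nat.card_zmultiples, hord₀]
  /- Step 2: two independent rational `2`-torsion points `P, Q`, and `E[2] = {O, P, Q, P + Q}`. -/
  have h2K : ((2 : ℕ) : ℚ) ≠ 0 := by norm_num
  haveI : Finite (geomTorsion W ((2 : ℕ) : ℤ)) := finite_geomTorsion_natCast W two_ne_zero
  obtain ⟨P, Q, hP2, hQ2, hP0, hQ0, hPQ⟩ :
      ∃ P Q : W.geomPoints, 2 • P = 0 ∧ 2 • Q = 0 ∧ P ≠ 0 ∧ Q ≠ 0 ∧ P ≠ Q := by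
    haveI : Fintype (geomTorsion W ((2 : ℕ) : ℤ)) := Fintype.ofFinite _
    have h3 : 2 < Fintype.card (geomTorsion W ((2 : ℕ) : ℤ)) := by
      rw [← Nat.card_eq_fintype_card, natCard_geomTorsion_eq_sq W h2K]; norm_num
    obtain ⟨a, b, c, hab, hac, hbc⟩ := Fintype.two_lt_card_iff.1 h3
    have mem2 : ∀ x : geomTorsion W ((2 : ℕ) : ℤ), 2 • (x : W.geomPoints) = 0 := fun x ↦
      AddSubgroup.torsionBy.nsmul_iff.1 x.2
    have hne : ∀ {x y : geomTorsion W ((2 : ℕ) : ℤ)}, x ≠ y → (x : W.geomPoints) ≠ y :=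
      fun hxy h ↦ hxy (Subtype.ext h)
    by_cases ha : (a : W.geomPoints) = 0
    · refine ⟨b, c, mem2 b, mem2 c, fun hb ↦ hne hab (ha.trans hb.symm), fun hc ↦ hne hac
        (ha.trans hc.symm), hne hbc⟩
    · by_cases hb : (b : W.geomPoints) = 0
      · exact ⟨a, c, mem2 a, mem2 c, ha, fun hc ↦ hne hbc (hb.trans hc.symm), hne hac⟩
      · exact ⟨a, b, mem2 a, mem2 b, ha, hb, hne hab⟩
  have hE2 : ∀ {T : W.geomPoints}, 2 • T = 0 → T = 0 ∨ T = P ∨ T = Q ∨ T = P + Q :=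
    fun hT ↦ W.eq_zero_or_eq_or_eq_add_of_two_nsmul_eq_zero two_ne_zero hP2 hQ2 hP0 hQ0 hPQ hT
  -- Galois commutes with multiplication by integers
  have hsm : ∀ (V : WeierstrassCurve ℚ) (σ : Field.absoluteGaloisGroup ℚ) (k : ℤ)
      (X : V.geomPoints), σ • (k • X) = k • σ • X :=
    fun V σ k X ↦ smul_comm σ k X
  have hsmn : ∀ (V : WeierstrassCurve ℚ) (σ : Field.absoluteGaloisGroup ℚ) (k : ℕ)
      (X : V.geomPoints), σ • (k • X) = k • σ • X :=
    fun V σ k X ↦ smul_comm σ k X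
  -- a half `R` of `P`
  obtain ⟨R, hR⟩ : ∃ R : W.geomPoints, ((2 : ℕ) : ℤ) • R = P :=
    (W.baseChange (AlgebraicClosure ℚ)).zsmul_surjective_of_isAlgClosed (by norm_num) P
  rw [natCast_zsmul] at hR
  /- Step 3: the `2`-isogeny `g₁ : E → E₁ = E/⟨Q⟩`. -/
  set CQ : AddSubgroup W.geomPoints := AddSubgroup.zmultiples Q with hCQ
  have hordQ : addOrderOf Q = 2 := addOrderOf_eq_prime hQ2 hQ0
  have hCQcard : Nat.card CQ = 2 := by rw [Nat.card_zmultiples, hordQ]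
  have hCQfin : (CQ : Set W.geomPoints).Finite := by
    have h : Nat.card CQ ≠ 0 := by rw [hCQcard]; decide
    exact Nat.finite_of_card_ne_zero h
  have hCQstab : ∀ (σ : Field.absoluteGaloisGroup ℚ) (X : W.geomPoints), X ∈ CQ → σ • X ∈ CQ := by
    intro σ X hX
    rw [AddSubgroup.mem_zmultiples_iff] at hX
    obtain ⟨k, rfl⟩ := hX
    rw [hsm W σ k Q, h2 σ Q hQ2]
    exact AddSubgroup.zsmul_mem _ (AddSubgroup.mem_zmultiples Q) k
  obtain ⟨E₁, hE₁, g₁, -, hker₁, -, -⟩ :=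
    W.exists_isogeny_ker_eq_and_comp_eq_nsmul_holds CQ hCQfin hCQstab
  haveI := hE₁
  have hg₁Q : g₁ Q = 0 := by
    have : Q ∈ g₁.toAddMonoidHom.ker := hker₁ ▸ AddSubgroup.mem_zmultiples Q
    exact this
  have hCQmem : ∀ X : W.geomPoints, X ∈ CQ → X = 0 ∨ X = Q := by
    intro X hX
    rw [AddSubgroup.mem_zmultiples_iff] at hX
    obtain ⟨k, rfl⟩ := hX
    rcases Int.even_or_odd k with ⟨j, rfl⟩ | ⟨j, rfl⟩
    · left
      rw [add_zsmul, ← zsmul_add, ← two_nsmul, hQ2, zsmul_zero]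
    · right
      rw [add_zsmul, one_zsmul, add_eq_right, two_mul, add_zsmul, ← zsmul_add, ← two_nsmul, hQ2,
        zsmul_zero]
  have hg₁ker : ∀ X : W.geomPoints, g₁ X = 0 → X = 0 ∨ X = Q := fun X hX ↦
    hCQmem X (by rw [← hker₁]; exact hX)
  have hg₁P : g₁ P ≠ 0 := fun h ↦ by
    rcases hg₁ker P h with h' | h'
    · exact hP0 h'
    · exact hPQ h'
  have hg₁s₀ : g₁ s₀ ≠ 0 := fun h ↦ by
    rcases hg₁ker s₀ h with h' | h'
    · exact hs₀0 h'
    · have hdvd : addOrderOf s₀ ∣ 2 := addOrderOf_dvd_iff_nsmul_eq_zero.2 (by rw [h']; exact hQ2)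
      rw [hord₀] at hdvd
      have := Nat.le_of_dvd two_pos hdvd
      omega
  /- Step 4: the cyclic `Γ_ℚ`-stable subgroup `K = ⟨κ⟩`, `κ = g₁ R + g₁ s₀`, of order `4p`. -/
  set x : E₁.geomPoints := g₁ R with hx
  set y : E₁.geomPoints := g₁ s₀ with hy
  have h2x : 2 • x = g₁ P := by rw [hx, ← map_nsmul, hR]
  have h4x : 4 • x = 0 := by
    rw [show (4 : ℕ) = 2 * 2 by norm_num, ← smul_smul, h2x, ← map_nsmul, hP2, map_zero]
  have hordx : addOrderOf x = 4 := by
    have e := addOrderOf_eq_prime_pow (p := 2) (n := 1) (x := x)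
      (by rw [pow_one, h2x]; exact hg₁P) (by norm_num; exact h4x)
    norm_num at e
    exact e
  have hpy : p • y = 0 := by rw [hy, ← map_nsmul, hps₀, map_zero]
  have hordy : addOrderOf y = p := addOrderOf_eq_prime hpy hg₁s₀
  have hcop : Nat.Coprime 4 p := by
    have e := ((Nat.coprime_primes Nat.prime_two hp).2 (Ne.symm hp2)).pow_left 2
    norm_num at e
    exact e
  have h4p0 : 4 * p ≠ 0 := by omega
  set κ : E₁.geomPoints := x + y with hκ
  have hordκ : addOrderOf κ = 4 * p := by
    rw [hκ, (AddCommute.all x y).addOrderOf_add_eq_mul_addOrderOf_of_coprime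
      (by rw [hordx, hordy]; exact hcop), hordx, hordy]
  set Ks : AddSubgroup E₁.geomPoints := AddSubgroup.zmultiples κ with hKs
  have hKcard : Nat.card Ks = 4 * p := by rw [Nat.card_zmultiples, hordκ]
  have hKfin : (Ks : Set E₁.geomPoints).Finite := by
    have h : Nat.card Ks ≠ 0 := by rw [hKcard]; exact h4p0
    exact Nat.finite_of_card_ne_zero h
  have hκK : κ ∈ Ks := AddSubgroup.mem_zmultiples κ
  have hxK : x ∈ Ks := by
    -- `x = (p * p) • κ` since `p² ≡ 1 (mod 4)` and `p • y = 0`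
    obtain ⟨t, ht⟩ := hpodd
    have hppx : (p * p) • x = x := by
      have e : p * p = (t * t + t) * 4 + 1 := by rw [ht]; ring
      rw [e, add_nsmul, one_nsmul, ← smul_smul, h4x, smul_zero, zero_add]
    have hppy : (p * p) • y = 0 := by rw [← smul_smul, hpy, smul_zero]
    have e : (p * p) • κ = x := by rw [hκ, nsmul_add, hppx, hppy, add_zero]
    rw [← e]
    exact Ks.nsmul_mem hκK _
  have hyK : y ∈ Ks := by
    have e : y = κ - x := by rw [hκ, add_sub_cancel_left]
    rw [e]
    exact Ks.sub_mem hκK hxK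
  -- images under `g₁` of the `2`-torsion and of `S` lie in `K`
  have hPQ0 : g₁ (P + Q) = 2 • x := by rw [map_add, hg₁Q, add_zero, h2x]
  have hg₁2 : ∀ {T : W.geomPoints}, 2 • T = 0 → g₁ T ∈ Ks := by
    intro T hT
    rcases hE2 hT with rfl | rfl | rfl | rfl
    · rw [map_zero]; exact Ks.zero_mem
    · rw [← h2x]; exact Ks.nsmul_mem hxK 2
    · rw [hg₁Q]; exact Ks.zero_mem
    · rw [hPQ0]; exact Ks.nsmul_mem hxK 2
  have hg₁S : ∀ {s : W.geomPoints}, s ∈ S → g₁ s ∈ Ks := by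
    intro s hs
    rw [hSeq, AddSubgroup.mem_zmultiples_iff] at hs
    obtain ⟨k, rfl⟩ := hs
    rw [map_zsmul]
    exact Ks.zsmul_mem hyK k
  have hKstab : ∀ (σ : Field.absoluteGaloisGroup ℚ) (X : E₁.geomPoints), X ∈ Ks → σ • X ∈ Ks := by
    intro σ X hX
    rw [AddSubgroup.mem_zmultiples_iff] at hX
    obtain ⟨k, rfl⟩ := hX
    rw [hsm E₁ σ k κ]
    refine Ks.zsmul_mem ?_ k
    have hσR : 2 • (σ • R - R) = 0 := by
      rw [nsmul_sub, ← hsmn W σ 2 R, hR, h2 σ P hP2, sub_self]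
    have e : σ • κ = g₁ (σ • R - R) + x + g₁ (σ • s₀) := by
      rw [hκ, smul_add, hx, hy, ← g₁.map_smul, ← g₁.map_smul, map_sub, sub_add_cancel]
    rw [e]
    exact Ks.add_mem (Ks.add_mem (hg₁2 hσR) hxK) (hg₁S (hSstab σ s₀ hs₀S))
  /- Step 5: the quotient isogeny `g₂ : E₁ → E₂ = E₁/K` is a cyclic `ℚ`-isogeny of degree
  `#K = 4p` between elliptic curves over `ℚ` — excluded by `h4p`. -/
  obtain ⟨E₂, hE₂, g₂, -, hker₂, -, -⟩ :=
    E₁.exists_isogeny_ker_eq_and_comp_eq_nsmul_holds Ks hKfin hKstab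
  haveI := hE₂
  have hcyc : g₂.IsCyclic :=
    (AddSubgroup.isAddCyclic_iff_exists_zmultiples_eq_top _).mpr ⟨κ, by rw [hker₂, hKs]⟩
  have hdeg : g₂.degree = 4 * p := by
    rw [Isogeny.degree, hker₂, hKcard]
  exact h4p E₁ E₂ g₂ hcyc hdeg

/-- (F-p, PROVED) **Full rational `2`-torsion + `Y₀(4p)(ℚ) = ∅` ⇒ `p ∤ deg ψ` for every cyclic
`ℚ`-isogeny `ψ` out of `W`.**  The landed `hasIrreducibleModPGaloisRep_of_rational_two_torsion_of_degree_ne` (copied above)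
(Darmon–Merel Thm 2.2: kernel `⟨g₁R + g₁s₀⟩` of order `4p` on `W/⟨Q⟩`) makes `W[p]` irreducible, while the
`p`-part of a cyclic kernel would be a stable line (H1a).  REPLACES gen-2's H5 (`m ↦ 2m`) and H6
(`m ↦ 4m` on the `2`-neighbour): no new construction is needed. -/
theorem not_dvd_degree_of_fullTwoTorsion {W : WeierstrassCurve ℚ} [W.IsElliptic]
    (h2 : ∀ (σ : Field.absoluteGaloisGroup ℚ) (P : W.geomPoints), 2 • P = 0 → σ • P = P)
    {p : ℕ} (hp : p.Prime) (hp2 : p ≠ 2)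
    (h4p : ∀ (W₁ W₂ : WeierstrassCurve ℚ) [W₁.IsElliptic] [W₂.IsElliptic] (φ : Isogeny W₁ W₂),
      φ.IsCyclic → φ.degree ≠ 4 * p)
    {W'' : WeierstrassCurve ℚ} [W''.IsElliptic] (φ : Isogeny W W'') (hφ : φ.IsCyclic) :
    ¬ p ∣ φ.degree := by
  intro hpd
  haveI : Fact p.Prime := ⟨hp⟩
  have hirr := hasIrreducibleModPGaloisRep_of_rational_two_torsion_of_degree_ne' W h2 hp hp2 h4p
  obtain ⟨C, hCstab, hCcard⟩ := exists_stable_natCard_eq_of_isCyclic_dvd φ hφ hp hpd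
  exact (Mazur1978.not_hasIrreducibleModPGaloisRep_iff_exists_natCard_eq W p).mpr
    ⟨C, hCstab, hCcard⟩ hirr

/-- `Y₀(52)(ℚ) = ∅` from `Y₀(26)(ℚ) = ∅` (PROVED mod Klein–Fricke 13): a cyclic `52`-isogeny has a cyclic
factor of degree `26` (`Isogeny.exists_isCyclic_degree_eq_of_dvd`), excluded by the landed level `26`. -/
theorem isCyclic_degree_ne_fiftyTwo (h13 : kleinFrickeThirteen_exists_j_eq)
    (W₁ W₂ : WeierstrassCurve ℚ) [W₁.IsElliptic] [W₂.IsElliptic] (φ : Isogeny W₁ W₂)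
    (hφ : φ.IsCyclic) : φ.degree ≠ 4 * 13 := by
  intro hdeg
  obtain ⟨W₃, hW₃, ψ, hψ, hψd, -⟩ :=
    φ.exists_isCyclic_degree_eq_of_dvd hφ (show 26 ∣ φ.degree by rw [hdeg]; norm_num)
  haveI := hW₃
  exact isCyclic_degree_ne_twentySix h13 W₁ W₃ ψ hψ hψd

/-- (F5, PROVED, unconditional) No cyclic `ℚ`-isogeny out of a Frey curve has degree divisible by `5`:
full rational `2`-torsion + the landed level `20` (`stub_levelTwenty` / `kenku_levelTwenty`). -/
theorem not_five_dvd_degree_freyCurve {a b : ℤ} (h0 : a * b * (a + b) ≠ 0) :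
    haveI := isElliptic_freyCurve h0
    ∀ (W'' : WeierstrassCurve ℚ) [W''.IsElliptic] (φ : Isogeny (freyCurve a b) W''), φ.IsCyclic →
      ¬ 5 ∣ φ.degree := by
  haveI := isElliptic_freyCurve h0
  intro W'' _ φ hφ
  exact not_dvd_degree_of_fullTwoTorsion (fun σ _ hT ↦ smul_eq_of_two_nsmul_eq_zero_freyCurve h0 σ hT)
    Nat.prime_five (by decide) (fun W₁ W₂ _ _ ψ hψ ↦ stub_levelTwenty W₁ W₂ ψ hψ) φ hφ

/-- (F13, PROVED mod Klein–Fricke 13) No cyclic `ℚ`-isogeny out of a Frey curve has degree divisible by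
`13`: full rational `2`-torsion + `Y₀(52)(ℚ) = ∅` (`isCyclic_degree_ne_fiftyTwo`). -/
theorem not_thirteen_dvd_degree_freyCurve (h13 : kleinFrickeThirteen_exists_j_eq) {a b : ℤ}
    (h0 : a * b * (a + b) ≠ 0) :
    haveI := isElliptic_freyCurve h0
    ∀ (W'' : WeierstrassCurve ℚ) [W''.IsElliptic] (φ : Isogeny (freyCurve a b) W''), φ.IsCyclic →
      ¬ 13 ∣ φ.degree := by
  haveI := isElliptic_freyCurve h0
  intro W'' _ φ hφ
  exact not_dvd_degree_of_fullTwoTorsion (fun σ _ hT ↦ smul_eq_of_two_nsmul_eq_zero_freyCurve h0 σ hT)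
    (by norm_num) (by decide) (isCyclic_degree_ne_fiftyTwo h13) φ hφ

/-! ## 7. Frey prime support `{2, 3, 7}` (H8, PROVED: H1 + F5 + F13) -/

/-- (H8, PROVED) For a Frey curve with an odd multiplicative place, every prime dividing the degree of a
cyclic `ℚ`-isogeny out of it is `2`, `3` or `7`: `11, ≥ 17` by Cor. 4.4 (H1); `5` by F5 (level `20`);
`13` by F13 (level `26`, mod Klein–Fricke 13). -/
theorem frey_primeSupport (h44 : Mazur1978.cor44_valuation_j_le_one)
    (h13 : kleinFrickeThirteen_exists_j_eq) {a b : ℤ} (h0 : a * b * (a + b) ≠ 0)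
    {v : HeightOneSpectrum ℤ} (hv2 : Rat.HeightOneSpectrum.natGenerator v ≠ 2)
    (hv : (freyCurve a b).HasMultiplicativeReductionAt v) :
    haveI := isElliptic_freyCurve h0
    ∀ (W'' : WeierstrassCurve ℚ) [W''.IsElliptic] (φ : Isogeny (freyCurve a b) W''), φ.IsCyclic →
      ∀ p : ℕ, p.Prime → p ∣ φ.degree → p ∈ ({2, 3, 7} : Finset ℕ) := by
  haveI := isElliptic_freyCurve h0
  intro W'' _ φ hφ p hp hpd
  have h5 := mem_oddSupport_of_cor44 h44 φ hφ hv2 hv hp hpd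
  have hne5 : p ≠ 5 := by
    rintro rfl
    exact not_five_dvd_degree_freyCurve h0 W'' φ hφ hpd
  have hne13 : p ≠ 13 := by
    rintro rfl
    exact not_thirteen_dvd_degree_freyCurve h13 h0 W'' φ hφ hpd
  simp only [Finset.mem_insert, Finset.mem_singleton] at h5 ⊢
  omega

/-- Frey barrier exclusions `{21, 27, 32, 49}` at an odd multiplicative source: H4b + the landed
levels `32` and `49`. -/
theorem frey_barrier_excl {W : WeierstrassCurve ℚ} [W.IsElliptic] {v : HeightOneSpectrum ℤ}
    (hv2 : Rat.HeightOneSpectrum.natGenerator v ≠ 2) (hv : W.HasMultiplicativeReductionAt v)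
    (W'' : WeierstrassCurve ℚ) [W''.IsElliptic] (φ : Isogeny W W'') (hφ : φ.IsCyclic) :
    φ.degree ∉ ({21, 27, 32, 49} : Finset ℕ) := by
  intro hmem
  have hsplit : ∀ n ∈ ({21, 27, 32, 49} : Finset ℕ),
      n ∈ ({15, 21, 27} : Finset ℕ) ∨ n = 32 ∨ n = 49 := by decide
  rcases hsplit _ hmem with h | h | h
  · exact isCyclic_degree_not_mem_oddTables φ hφ hv2 hv h
  · exact isogeny_isCyclic_degree_ne_thirtyTwo φ hφ h
  · exact isogeny_isCyclic_degree_ne_fortyNine φ hφ h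

/-! ## 8. Assemblies (ALL PROVED — no `sorry` upstream any more) -/

/-- **PLAN A (PROVED).** The Frey/odd slice of Lemma 6.8 — the literal instance `stub_valTransport`
consumes — from Mazur Cor. 4.4 and Klein–Fricke(13) ONLY (both as hypotheses). -/
theorem lemma68FreyOdd_of_cor44_of_kleinFricke13 (h44 : Mazur1978.cor44_valuation_j_le_one)
    (h13 : kleinFrickeThirteen_exists_j_eq) : Lemma68FreyOdd := by
  intro a b hab h0 W' _ hiso v hv2 hv
  haveI := isElliptic_freyCurve h0
  obtain ⟨φ, hφ⟩ := radius_at_of_support_of_barrier ({2, 3, 7} : Finset ℕ)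
    ({21, 27, 32, 49} : Finset ℕ) (by decide) freyBarrier_covers
    (frey_primeSupport h44 h13 h0 hv2 hv) (frey_barrier_excl hv2 hv) hiso
  exact lemma68At_of_degree_le φ hφ v hv

/-- The FREY-CLASS RADIUS (feeds `stub_pasten163` as well, via duals): every curve `ℚ`-isogenous to
a Frey curve with an odd multiplicative place is reached from it by an isogeny of degree `≤ 163`. -/
theorem freyRadius_of_cor44_of_kleinFricke13 (h44 : Mazur1978.cor44_valuation_j_le_one)
    (h13 : kleinFrickeThirteen_exists_j_eq) {a b : ℤ} (h0 : a * b * (a + b) ≠ 0)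
    {v : HeightOneSpectrum ℤ} (hv2 : Rat.HeightOneSpectrum.natGenerator v ≠ 2)
    (hv : (freyCurve a b).HasMultiplicativeReductionAt v) :
    haveI := isElliptic_freyCurve h0
    ∀ (W' : WeierstrassCurve ℚ) [W'.IsElliptic], (freyCurve a b).IsIsogenous W' →
      ∃ φ : Isogeny (freyCurve a b) W', φ.degree ≤ 163 := by
  haveI := isElliptic_freyCurve h0
  intro W' _ hiso
  exact radius_at_of_support_of_barrier ({2, 3, 7} : Finset ℕ) ({21, 27, 32, 49} : Finset ℕ)
    (by decide) freyBarrier_covers (frey_primeSupport h44 h13 h0 hv2 hv) (frey_barrier_excl hv2 hv)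
    hiso

/-- **PLAN B.** The odd slice for ALL curves: Cor. 4.4 + Klein–Fricke(13) + the three open smooth
levels `65, 125, 169` (the residual of stmt-ABC-18224); the seven prime `j`-tables are NOT needed. -/
theorem lemma68Odd_of_cor44_of_kleinFricke13_of_threeLevels
    (h44 : Mazur1978.cor44_valuation_j_le_one) (h13 : kleinFrickeThirteen_exists_j_eq)
    (hL3 : ∀ (V V' : WeierstrassCurve ℚ) [V.IsElliptic] [V'.IsElliptic] (ψ : Isogeny V V'),
      ψ.IsCyclic → ψ.degree ∉ ({65, 125, 169} : Finset ℕ)) :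
    Lemma68Odd := by
  intro W W' _ _ hiso v hv2 hv
  have hexcl : ∀ (W'' : WeierstrassCurve ℚ) [W''.IsElliptic] (φ : Isogeny W W''), φ.IsCyclic →
      φ.degree ∉ ({15, 20, 21, 26, 27, 32, 35, 49, 65, 125, 169} : Finset ℕ) := by
    intro W'' _ φ hφ hmem
    have hsplit : ∀ n ∈ ({15, 20, 21, 26, 27, 32, 35, 49, 65, 125, 169} : Finset ℕ),
        n ∈ ({15, 21, 27} : Finset ℕ) ∨ n = 20 ∨ n = 26 ∨ n = 32 ∨ n = 35 ∨ n = 49 ∨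
          n ∈ ({65, 125, 169} : Finset ℕ) := by decide
    rcases hsplit _ hmem with h | h | h | h | h | h | h
    · exact isCyclic_degree_not_mem_oddTables φ hφ hv2 hv h
    · exact stub_levelTwenty W W'' φ hφ h
    · exact isCyclic_degree_ne_twentySix h13 W W'' φ hφ h
    · exact isogeny_isCyclic_degree_ne_thirtyTwo φ hφ h
    · exact isCyclic_degree_ne_thirtyFive W W'' φ hφ h
    · exact isogeny_isCyclic_degree_ne_fortyNine φ hφ h
    · exact hL3 W W'' φ hφ h
  obtain ⟨φ, hφ⟩ := radius_at_of_support_of_barrier ({2, 3, 5, 7, 13} : Finset ℕ)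
    ({15, 20, 21, 26, 27, 32, 35, 49, 65, 125, 169} : Finset ℕ) (by decide) oddBarrier_covers
    (fun W'' _ ψ hψ p hp hpd ↦ mem_oddSupport_of_cor44 h44 ψ hψ hv2 hv hp hpd) hexcl hiso
  exact lemma68At_of_degree_le φ hφ v hv

/-- PLAN C (for the record; k1/k2): the verbatim stub from the radius item `MazurKenkuRadius`. -/
theorem lemma68_of_radius (hRad : Summit.ABC.ABC.Theses.IsogenyGlueCongruence.MazurKenkuRadius) :
    PastenShimura2024_lemma_6_8 := by
  intro W W' _ _ hiso v hv
  obtain ⟨φ, hφ⟩ := hRad W W' hiso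
  exact lemma68At_of_degree_le φ hφ v hv

end Summit.ABC.ABC.Cruxes.DefiniteRTControlPrime.StubIdeas3G3

/-! ## 9. RESHAPE CERTIFICATE: the skeleton's consumer accepts the re-cut stub (proved) -/

namespace Summit.ABC.ABC.Cruxes.DefiniteRTControlPrime.StubIdeas3G3

open Summit.ABC.ABC.Theses.DefiniteXi
open Literature.NumberTheory.Automorphic
open Summit.ABC.ABC.Theorems.DefiniteRTControlPrime

/-- `stub_valTransport` with `PastenShimura2024_lemma_6_8` replaced by `Lemma68FreyOdd`
(body verbatim; the one call of `h68` is at a Frey source and an odd place). -/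
theorem valTransport_of_lemma68FreyOdd : Lemma68FreyOdd →
    ∀ (a b : ℤ), IsCoprime a b → a * b * (a + b) ≠ 0 → ∀ q : ℕ, q.Prime → q ≠ 2 →
      q ∣ (freyCurve a b).conductorNorm ℤ →
      ∀ (W' : WeierstrassCurve ℚ) [W'.IsElliptic], (freyCurve a b).IsIsogenous W' →
        (W'.minimalDiscriminantNorm ℤ).factorization q ≤
          163 * ((freyCurve a b).minimalDiscriminantNorm ℤ).factorization q := by
  intro h68 a b hab h0 q hq hq2 hqN W' _ hiso
  haveI := isElliptic_freyCurve h0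
  obtain ⟨v, hv⟩ :
      ∃ v : IsDedekindDomain.HeightOneSpectrum ℤ, Rat.HeightOneSpectrum.natGenerator v = q :=
    ⟨(Rat.HeightOneSpectrum.primesEquiv (R := ℤ)).symm ⟨q, hq⟩,
      Rat.natGenerator_primesEquiv_symm ⟨q, hq⟩⟩
  have hdvd : (q : ℤ) ∣ a * b * (a + b) :=
    Literature.NumberTheory.DiophantineGeometry.dvd_of_dvd_conductorNorm_freyCurve hab h0 hq hq2 hqN
  have hmult : (freyCurve a b).HasMultiplicativeReductionAt v :=
    Literature.NumberTheory.DiophantineGeometry.hasMultiplicativeReductionAt_freyCurve_of_ne_two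
      hab h0 v (hv ▸ hq2) (hv ▸ hdvd)
  obtain ⟨m, n, hm0, -, -, hn, hmn⟩ := h68 a b hab h0 W' hiso v (hv ▸ hq2) hmult
  have h1 := factorization_minimalDiscriminantNorm_holds (freyCurve a b) v
  have h2 := factorization_minimalDiscriminantNorm_holds W' v
  rw [hv] at h1 h2
  rw [h1, h2]
  calc W'.ordMinimalDiscriminant v
      ≤ W'.ordMinimalDiscriminant v * m := Nat.le_mul_of_pos_right _ hm0
    _ = (freyCurve a b).ordMinimalDiscriminant v * n := hmn.symm
    _ ≤ (freyCurve a b).ordMinimalDiscriminant v * 163 := Nat.mul_le_mul_left _ hn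
    _ = 163 * (freyCurve a b).ordMinimalDiscriminant v := Nat.mul_comm _ _

/-- **THE RE-CUT STUB, DISCHARGED.**  The conclusion of the skeleton's `stub_valTransport h68` — the only
use of `h68 : PastenShimura2024_lemma_6_8` in `DefiniteRTControlPrime_of_facts` — from Mazur Cor. 4.4 and
Klein–Fricke(13) alone (no Lemma 6.8, no Mazur–Kenku classification). -/
theorem valTransport_of_cor44_of_kleinFricke13 (h44 : Mazur1978.cor44_valuation_j_le_one)
    (h13 : kleinFrickeThirteen_exists_j_eq) :
    ∀ (a b : ℤ), IsCoprime a b → a * b * (a + b) ≠ 0 → ∀ q : ℕ, q.Prime → q ≠ 2 →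
      q ∣ (freyCurve a b).conductorNorm ℤ →
      ∀ (W' : WeierstrassCurve ℚ) [W'.IsElliptic], (freyCurve a b).IsIsogenous W' →
        (W'.minimalDiscriminantNorm ℤ).factorization q ≤
          163 * ((freyCurve a b).minimalDiscriminantNorm ℤ).factorization q :=
  valTransport_of_lemma68FreyOdd (lemma68FreyOdd_of_cor44_of_kleinFricke13 h44 h13)

/-- The same, keyed to the LEDGER: `h44` is literally the open route item stmt-ABC-18223
`IsogenyGlueCongruence.MazurCor44` (body verbatim `Mazur1978.cor44_valuation_j_le_one`, so the two
`Prop`s are definitionally equal), `h13` the cite-only fact `kleinFrickeThirteen_exists_j_eq`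
(shared with item `KenkuPrintedLevels` (ii)).  Bill of the re-cut leaf = {stmt-ABC-18223, KF13}. -/
theorem valTransport_of_mazurCor44_item_of_kleinFricke13
    (h44 : Summit.ABC.ABC.Theses.IsogenyGlueCongruence.MazurCor44)
    (h13 : kleinFrickeThirteen_exists_j_eq) :
    ∀ (a b : ℤ), IsCoprime a b → a * b * (a + b) ≠ 0 → ∀ q : ℕ, q.Prime → q ≠ 2 →
      q ∣ (freyCurve a b).conductorNorm ℤ →
      ∀ (W' : WeierstrassCurve ℚ) [W'.IsElliptic], (freyCurve a b).IsIsogenous W' →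
        (W'.minimalDiscriminantNorm ℤ).factorization q ≤
          163 * ((freyCurve a b).minimalDiscriminantNorm ℤ).factorization q :=
  valTransport_of_cor44_of_kleinFricke13 h44 h13

end Summit.ABC.ABC.Cruxes.DefiniteRTControlPrime.StubIdeas3G3

end
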